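import Mathlib

/-!
# Complete monotonicity from the four Hankel square-positivities

Let `a : ℕ → ℝ` and let `L` be the linear functional on real polynomials with `L(Xⁿ) = a n`.
If `L(p²) ≥ 0`, `L(X p²) ≥ 0`, `L((1 - X) p²) ≥ 0` and `L(X (1 - X) p²) ≥ 0` for every real
polynomial `p` — in terms of the sequence: the Hankel forms `(i, j) ↦ a (i + j)` and
`(i, j) ↦ a (i + j + 1)` are positive semidefinite and dominate their shifts — then `a` is
completely monotone: `∑_{i ≤ k} (-1)^i (k choose i) a (n + i) = L(Xⁿ (1 - X)ᵏ) ≥ 0` for all `n, k`.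
This is the algebraic half of the characterisation of Hausdorff moment sequences (moment sequences
of positive measures on `[0, 1]`) by positive definiteness on the semigroup `(ℕ, +)`.

Proof: write `n = 2 n' + r`, `k = 2 k' + r'` with `r, r' ∈ {0, 1}` and `q = X^{n'} (1 - X)^{k'}`;
then `Xⁿ (1 - X)ᵏ = Xʳ (1 - X)^{r'} q²`, so `L(Xⁿ (1 - X)ᵏ)` is one of the four nonnegative
quantities. The functional `L` is realised concretely as `p ↦ ∑_{m < D} (coeff p m) · a m` for a
large cut-off `D`, which keeps the file free of definitions.

* `hankel_alternating` — the theorem.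

## References

* C. Berg, J. P. R. Christensen, P. Ressel, *Harmonic Analysis on Semigroups*, Graduate Texts in
  Mathematics 100, Springer (1984), Ch. 4, Prop. 6.11 and Ch. 6, Thm. 2.5.
  [BergChristensenRessel1984]
* F. Hausdorff, Summationsmethoden und Momentfolgen I, Math. Z. 9 (1921), 74–109.
-/

noncomputable section

open MeasureTheory Set Filter Topology Polynomial

namespace Literature.MeasureTheory.Integral

namespace HankelCompletelyMonotone

/-- The truncated moment functional `p ↦ ∑_{m < D} (coeff p m) a m` evaluated on an explicit
finite combination of monomials `∑_{i ∈ s} (b i) X^{g i}` of degrees `< D`. [folklore] -/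
theorem sum_coeff_sum_C_mul_X_pow_mul {ι : Type*} (a : ℕ → ℝ) (s : Finset ι) (b : ι → ℝ)
    (g : ι → ℕ) (D : ℕ) (hg : ∀ i ∈ s, g i < D) :
    ∑ m ∈ Finset.range D, (∑ i ∈ s, C (b i) * X ^ (g i)).coeff m * a m =
      ∑ i ∈ s, b i * a (g i) := by
  simp only [finsetSum_coeff, coeff_C_mul_X_pow, Finset.sum_mul, ite_mul, zero_mul]
  rw [Finset.sum_comm]
  refine Finset.sum_congr rfl fun i hi => ?_
  rw [Finset.sum_ite_eq', if_pos (Finset.mem_range.2 (hg i hi))]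

/-- Binomial expansion: `Xⁿ (1 - X)ᵏ = ∑_{l ≤ k} (-1)^l (k choose l) X^{n + l}`. [folklore] -/
theorem X_pow_mul_one_sub_X_pow (n k : ℕ) :
    (X : ℝ[X]) ^ n * (1 - X) ^ k =
      ∑ l ∈ Finset.range (k + 1), C ((-1 : ℝ) ^ l * (k.choose l : ℝ)) * X ^ (n + l) := by
  have h1 : (1 : ℝ[X]) - X = C (-1) * X + 1 := by
    rw [map_neg, map_one, neg_one_mul, sub_eq_neg_add]
  rw [h1, add_pow, Finset.mul_sum]
  refine Finset.sum_congr rfl fun l _ => ?_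
  simp only [mul_pow, one_pow, mul_one, map_mul, map_pow, map_natCast, pow_add]
  ring

/-- `L(Xⁿ (1 - X)ᵏ) = ∑_{i ≤ k} (-1)^i (k choose i) a (n + i)` for the truncated moment
functional `L p = ∑_{m < D} (coeff p m) a m`, `D > n + k`. [folklore] -/
theorem sum_coeff_X_pow_mul_one_sub_X_pow_mul (a : ℕ → ℝ) (n k D : ℕ) (hD : n + k < D) :
    ∑ m ∈ Finset.range D, ((X : ℝ[X]) ^ n * (1 - X) ^ k).coeff m * a m =
      ∑ i ∈ Finset.range (k + 1), (-1 : ℝ) ^ i * (k.choose i : ℝ) * a (n + i) := by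
  rw [X_pow_mul_one_sub_X_pow]
  exact sum_coeff_sum_C_mul_X_pow_mul a _ _ _ D fun i hi => by
    have := Finset.mem_range.1 hi
    omega

/-- `L(Xᵉ q²) = ∑_{i, j ∈ s} cᵢ cⱼ a (i + j + e)` for `q = ∑_{i ∈ s} cᵢ Xⁱ` and the truncated
moment functional `L p = ∑_{m < D} (coeff p m) a m` with `D` beyond the degree of `Xᵉ q²`.
[folklore] -/
theorem sum_coeff_X_pow_mul_sq_mul (a : ℕ → ℝ) (s : Finset ℕ) (c : ℕ → ℝ) (e D : ℕ)
    (hD : ∀ i ∈ s, ∀ j ∈ s, i + j + e < D) :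
    ∑ m ∈ Finset.range D,
        ((X : ℝ[X]) ^ e * (∑ i ∈ s, C (c i) * X ^ i) * (∑ i ∈ s, C (c i) * X ^ i)).coeff m * a m =
      ∑ i ∈ s, ∑ j ∈ s, c i * c j * a (i + j + e) := by
  have h : (X : ℝ[X]) ^ e * (∑ i ∈ s, C (c i) * X ^ i) * (∑ i ∈ s, C (c i) * X ^ i) =
      ∑ p ∈ s ×ˢ s, C (c p.1 * c p.2) * X ^ (p.1 + p.2 + e) := by
    rw [mul_assoc, Finset.sum_mul_sum, Finset.mul_sum, Finset.sum_product]
    refine Finset.sum_congr rfl fun i _ => ?_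
    rw [Finset.mul_sum]
    refine Finset.sum_congr rfl fun j _ => ?_
    simp only [map_mul, pow_add]
    ring
  have hb : ∀ p ∈ s ×ˢ s, p.1 + p.2 + e < D := fun p hp => by
    obtain ⟨h1, h2⟩ := Finset.mem_product.1 hp
    exact hD _ h1 _ h2
  rw [h, sum_coeff_sum_C_mul_X_pow_mul a (s ×ˢ s) (fun p : ℕ × ℕ => c p.1 * c p.2)
    (fun p : ℕ × ℕ => p.1 + p.2 + e) D hb, Finset.sum_product]

end HankelCompletelyMonotone

open HankelCompletelyMonotone in
/-- **Complete monotonicity from the four square-positivities** (Hausdorff; Berg–Christensen–Ressel).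
If the Hankel forms of a real sequence `a` at shifts `0` and `1` are positive semidefinite
(`L(p²) ≥ 0`, `L(X p²) ≥ 0` for the functional `L(Xⁿ) = a n`) and dominate their shifts
(`L((1 - X) p²) ≥ 0`, `L(X (1 - X) p²) ≥ 0`), then `a` is completely monotone:
`∑_{i ≤ k} (-1)^i (k choose i) a (n + i) ≥ 0` for all `n k`. Proof: with `n = 2n' + r`,
`k = 2k' + r'`, `r, r' ∈ {0, 1}`, one has `Xⁿ (1 - X)ᵏ = Xʳ (1 - X)^{r'} (X^{n'} (1 - X)^{k'})²`.
[cite: BergChristensenRessel1984, Ch. 4, Prop. 6.11 with Ch. 6, Thm. 2.5] -/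
theorem hankel_alternating (a : ℕ → ℝ)
    (hP0 : ∀ (s : Finset ℕ) (c : ℕ → ℝ), 0 ≤ ∑ i ∈ s, ∑ j ∈ s, c i * c j * a (i + j))
    (hP1 : ∀ (s : Finset ℕ) (c : ℕ → ℝ), 0 ≤ ∑ i ∈ s, ∑ j ∈ s, c i * c j * a (i + j + 1))
    (hP2 : ∀ (s : Finset ℕ) (c : ℕ → ℝ),
      ∑ i ∈ s, ∑ j ∈ s, c i * c j * a (i + j + 1) ≤ ∑ i ∈ s, ∑ j ∈ s, c i * c j * a (i + j))
    (hP2' : ∀ (s : Finset ℕ) (c : ℕ → ℝ),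
      ∑ i ∈ s, ∑ j ∈ s, c i * c j * a (i + j + 2) ≤ ∑ i ∈ s, ∑ j ∈ s, c i * c j * a (i + j + 1)) :
    ∀ n k : ℕ, 0 ≤ ∑ i ∈ Finset.range (k + 1), (-1 : ℝ) ^ i * (k.choose i : ℝ) * a (n + i) := by
  intro n k
  -- parities: `n = 2 n' + r`, `k = 2 k' + r'`
  obtain ⟨n', r, rfl, hr⟩ : ∃ n' r : ℕ, n = 2 * n' + r ∧ r < 2 :=
    ⟨n / 2, n % 2, (Nat.div_add_mod n 2).symm, Nat.mod_lt n two_pos⟩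
  obtain ⟨k', r', rfl, hr'⟩ : ∃ k' r' : ℕ, k = 2 * k' + r' ∧ r' < 2 :=
    ⟨k / 2, k % 2, (Nat.div_add_mod k 2).symm, Nat.mod_lt k two_pos⟩
  -- the goal is `L(Xⁿ (1 - X)ᵏ)` for the truncated moment functional with cut-off `D = n + k + 1`
  rw [← sum_coeff_X_pow_mul_one_sub_X_pow_mul a (2 * n' + r) (2 * k' + r')
    (2 * n' + r + (2 * k' + r') + 1) (Nat.lt_succ_self _)]
  -- `q = X^{n'} (1 - X)^{k'} = ∑_{i ∈ s} cᵢ Xⁱ` with `s = n' + {0, …, k'}`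
  obtain ⟨q, hq_def⟩ : ∃ q : ℝ[X], q = X ^ n' * (1 - X) ^ k' := ⟨_, rfl⟩
  obtain ⟨s, hs⟩ : ∃ s : Finset ℕ, s = Finset.image (fun l => n' + l) (Finset.range (k' + 1)) :=
    ⟨_, rfl⟩
  obtain ⟨c, hc⟩ : ∃ c : ℕ → ℝ, c = fun i => (-1 : ℝ) ^ (i - n') * (k'.choose (i - n') : ℝ) :=
    ⟨_, rfl⟩
  have hq : q = ∑ i ∈ s, C (c i) * X ^ i := by
    rw [hs, Finset.sum_image fun x _ y _ h => Nat.add_left_cancel h, hq_def,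
      X_pow_mul_one_sub_X_pow]
    refine Finset.sum_congr rfl fun l _ => ?_
    simp only [hc, Nat.add_sub_cancel_left]
  have hmem : ∀ i ∈ s, i ≤ n' + k' := by
    intro i hi
    rw [hs, Finset.mem_image] at hi
    obtain ⟨l, hl, rfl⟩ := hi
    have := Finset.mem_range.1 hl
    omega
  have hsD1 : ∀ i ∈ s, ∀ j ∈ s, i + j + r < 2 * n' + r + (2 * k' + r') + 1 :=
    fun i hi j hj => by
      have := hmem i hi
      have := hmem j hj
      omega
  rcases (show r' = 0 ∨ r' = 1 by omega) with rfl | rfl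
  · -- `k` even: `Xⁿ (1 - X)ᵏ = Xʳ q²`, and `L(Xʳ q²) ≥ 0` is `hP0` (`r = 0`) or `hP1` (`r = 1`)
    have key : (X : ℝ[X]) ^ (2 * n' + r) * (1 - X) ^ (2 * k' + 0) = X ^ r * q * q := by
      rw [hq_def]
      ring
    rw [key, hq, sum_coeff_X_pow_mul_sq_mul a s c r _ hsD1]
    rcases (show r = 0 ∨ r = 1 by omega) with rfl | rfl
    · simpa only [add_zero] using hP0 s c
    · exact hP1 s c
  · -- `k` odd: `Xⁿ (1 - X)ᵏ = Xʳ q² - X^{r+1} q²`, and `L(X^{r+1} q²) ≤ L(Xʳ q²)` is `hP2`/`hP2'`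
    have hsD2 : ∀ i ∈ s, ∀ j ∈ s, i + j + (r + 1) < 2 * n' + r + (2 * k' + 1) + 1 :=
      fun i hi j hj => by
        have := hmem i hi
        have := hmem j hj
        omega
    have key : (X : ℝ[X]) ^ (2 * n' + r) * (1 - X) ^ (2 * k' + 1) =
        X ^ r * q * q - X ^ (r + 1) * q * q := by
      rw [hq_def]
      ring
    rw [key]
    simp only [coeff_sub, sub_mul, Finset.sum_sub_distrib, sub_nonneg]
    rw [hq, sum_coeff_X_pow_mul_sq_mul a s c r _ hsD1, sum_coeff_X_pow_mul_sq_mul a s c (r + 1) _ hsD2]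
    rcases (show r = 0 ∨ r = 1 by omega) with rfl | rfl
    · simpa only [add_zero, zero_add] using hP2 s c
    · simpa only [Nat.reduceAdd] using hP2' s c

end Literature.MeasureTheory.Integral

end
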